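import Summits.BirchSwinnertonDyer.Rank1Residual.X11a.ChainDischarge
import Literature.NumberTheory.EllipticCurves.OrdinaryPadicDataExistsProofs
import Literature.NumberTheory.EllipticCurves.GreenbergSelmerDualDataExistsProofs
import Literature.NumberTheory.EllipticCurves.GreenbergSelmerCharIdealPrincipalProofs
import HarnessLib

/-!
# Class X11a, surjective leaf, `p ≥ 5`: BSD(E,p) from NAMED published facts + the per-pair
# certificate — the existence inputs (E1)–(E3) supplied by THEOREMS
# (cell `b2b-bsdres`, unit `b2b-bsdres-x11a`, gen 15; E1–E3 discharged by harvest-2 gens 9–10)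

Provenance: this is the `x11a` seat's file `work/X11a/ChainNamedFacts.lean` (gen 15, written to
land "the moment" its fact file `WeightKMemberData.lean` p205324 did), filed by the harvest-2 seat
(gen 10) on x11a's behalf after p205324 was bounced by review as already proved: the three binders
`hE1 hE2 hE3` are replaced by the named facts `DeligneSerre1974.thm61_exists_adicGaloisRep`,
`Hida2000_thm326_ordinary` (feeding harvest-2's E1 theorem) and by harvest-2's unconditional E2/E3
theorems; nothing else is changed.

HONEST FRAMING (run/shared/lean/b2b/bsd-rank1-residual/, verbatim in every file): the goal of the
cell is to DELETE the COMBINATION-SHAPED residual classes of the Birch–Swinnerton-Dyer formula for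
ALL analytic-rank `≤ 1` elliptic curves over `ℚ` — "full BSD formula for every rank `≤ 1` curve in
class `C`" assembled STRICTLY from published theorems — so that the rank-`≤ 1` remainder becomes
exactly the CONSTRUCTION-SHAPED classes, which are TYPED (missing-input `Prop`s), NOT attempted.
This is not "finishing BSD". Research route; NO CLAIM BEYOND STATED CLASSES. One theorem; every
input is an explicit NAMED-FACT hypothesis plus the certificate.

`X11a/ChainDischarge.lean` (`forall_bsdp_of_facts`, p205400) proves BSD(E,p) on X11a ∩ {`p ≥ 5`,
`ρ̄` surjective} from the named facts of the chain (Hida member; Mazur–Tate–Teitelbaum; EPW 2006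
Thm 3.1.1 / Thm 1 / Thm 5.1.3; Wan 2015 Thm 4; Kato–Wuthrich A32; Stein–Wuthrich Thm 6.1 + heights;
Greenberg–Stevens; GZK; modularity) and three displayed existence inputs. Here those inputs are
DISCHARGED by the Literature THEOREMS of the harvest-2 seat (gens 9–10):
(E1) `exists_ordinaryPadicData_weightK_member_of_thm61_of_thm326` (EPW §3.1: integral model +
ordinary filtration, from the named facts Deligne–Serre `thm61_exists_adicGaloisRep` and Hida
`Hida2000_thm326_ordinary` = Wiles 1988 Thm 2.2; `OrdinaryPadicDataExistsProofs.lean`, p205893),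
(E2) `GreenbergSelmer.exists_dualData_weightK_member_unconditional` (EPW §3.1 / Greenberg 1989 §1:
the `Λ_𝒪`-dual; `GreenbergSelmerDualDataExistsProofs.lean`, p206456), (E3)
`charIdeal_isPrincipal_weightK_member_unconditional` (structure theory over `𝒪⟦T⟧`, Washington
§13.2; `GreenbergSelmerCharIdealPrincipalProofs.lean`, p206115). RESULT `forall_bsdp_of_namedFacts`:
every binder is a named PUBLISHED fact (Deligne–Serre Thm 6.1 and Hida 3.26 join the list in place
of E1; E2/E3 leave it) — on this
sub-class BSD(E,p) follows from the published record plus ONE finite certificate per pair,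
`X11a.MuAnZeroAt W p`; the class-level residue is Greenberg's `μ`-conjecture (OPEN, NAMED, typed).
No label change by this file (cell lead / referee).

References: [EmertonPollackWeston2006] §3.1, Thm. 1, 3.1.1, 5.1.3; [Wan2015] Thm. 4; [Wiles1988]
Thm. 2.2; [Greenberg1989] §1; [Washington1997] §13.2; HOME/b2b-bsdres-x11a/REPORT-g15.md.
-/

noncomputable section

open scoped Classical MatrixGroups ModularForm

open CongruenceSubgroup WeierstrassCurve Literature.NumberTheory.EllipticCurves
  Literature.NumberTheory.EllipticCurves.ModularForms
  Literature.NumberTheory.EllipticCurves.Rank1Residual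
  Literature.NumberTheory.EllipticCurves.Rank1Residual.Typed
  Literature.NumberTheory.EllipticCurves.Wuthrich2014
  Literature.NumberTheory.EllipticCurves.SteinWuthrich2013
  Literature.NumberTheory.EllipticCurves.GreenbergVatsal2000
  Literature.NumberTheory.EllipticCurves.EmertonPollackWeston2006
  Summit.BirchSwinnertonDyer.Rank1Residual.X1.MuLambda
  Summit.BirchSwinnertonDyer.Rank1Residual.X11a.LambdaNorm

set_option autoImplicit false

namespace Summit.BirchSwinnertonDyer.Rank1Residual.X11a

open Chain

/-- **X11a ∩ {`p ≥ 5`, `ρ̄_{E,p}` surjective}: `BSD(E,p)` ⇐ NAMED PUBLISHED FACTS + the per-pair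
certificate `μ^an(E,p) = 0` — no displayed hypothesis.** The existence inputs (E1)–(E3) are
THEOREMS: `exists_ordinaryPadicData_weightK_member_of_thm61_of_thm326` (EPW §3.1 / Deligne /
Wiles 88 Thm 2.2; granted the named facts `DeligneSerre1974.thm61_exists_adicGaloisRep` and
`Hida2000_thm326_ordinary`, harvest-2 p205893), `GreenbergSelmer.exists_dualData_weightK_member_unconditional`
(EPW §3.1 / Greenberg 1989 §1; harvest-2 p206456) and `charIdeal_isPrincipal_weightK_member_unconditional`
(structure theory over `𝒪⟦T⟧`, Washington §13.2; harvest-2 p206115). Every other binder is a named published fact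
(Hida member, MTT, EPW Thm 3.1.1 / Thm 1 / Thm 5.1.3, Wan Thm 4, Kato–Wuthrich A32, Stein–Wuthrich
Thm 6.1 + heights, Greenberg–Stevens, GZK, modularity). In words: on X11a's surjective leaf at
`p ≥ 5`, the `p`-part of BSD follows from the published record plus ONE finite certificate per pair
(`X11a.MuAnZeroAt`: the Néron-normalised Mazur–Tate–Teitelbaum series has a unit coefficient) —
the class-level residue being Greenberg's `μ`-conjecture for irreducible `E[p]` (OPEN, NAMED,
typed). No label change is made by this theorem (cell lead / referee; informational flags on the
facts: `Wan15-Thm103-Fujiwara`, `EPW-canonical-period`, Greenberg-vs-classical Selmer).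
[cite: EmertonPollackWeston2006, Thm. 1, Thm. 3.1.1, Thm. 5.1.3, §3.1] [cite: Wan2015, Thm. 4]
[cite: SteinWuthrich2013, Thm. 6.1 (p. 20)] [cite: Wuthrich2014, Thm. 3 (p. 382) and Cor. 19 proof (p. 399)] -/
theorem forall_bsdp_of_namedFacts
    (hHida : hida_exists_congruent_ordinary_newform_of_multiplicative)
    (hMTT : exists_isCycPAdicLFunctionWeightK)
    (h311 : thm311_cotorsion_weightK_member) (hT1a : thm1_muAlg_of_weightK_member)
    (hT2 : Wan2015.thm4_rational_weightK_member) (hT1b : thm513_transfer_from_weightK_member)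
    (h61 : DeligneSerre1974.thm61_exists_adicGaloisRep) (h326 : Hida2000_thm326_ordinary)
    (hKato : kato_charIdeal_dvd_multiplicative_of_surjective)
    (hJs : thm61_splitMultiplicative) (hJn : thm61_nonsplitMultiplicative)
    (hHs : exists_isSplitMultCanonical) (hHn : exists_isMultCanonical)
    (hGZK : rank_eq_analyticRank_of_analyticRank_le_one) (hmod : hasEntireLFunction_rat)
    (hpar : nonempty_modularParametrizationData)
    (hGS : ∀ (W : WeierstrassCurve ℚ) [W.IsElliptic] [W.IsGloballyMinimal] (p : ℕ) [Fact p.Prime],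
      greenberg_stevens (W := W) (p := p)) :
    ∀ (W : WeierstrassCurve ℚ) [W.IsElliptic] [W.IsGloballyMinimal] (p : ℕ) [Fact p.Prime],
      ClassX11a W p → 5 ≤ p → Surj W p → MuAnZeroAt W p → BSDp W p := by
  intro W _ _ p _ hX hp hsurj hμ
  haveI : NeZero (W.conductorNorm ℤ / p) := neZero_conductorNorm_div W p hX.2.2.1
  haveI : NeZero p := ⟨(Fact.out : p.Prime).ne_zero⟩
  have hmult : W.HasMultiplicativeReductionAtPrime p := hX.2.2.1
  have hirr : W.HasIrreducibleModPGaloisRep p :=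
    hasIrreducibleModPGaloisRep_of_hasSurjectiveModNGaloisRep W p hsurj
  exact bsdp_of_facts W p hHida hMTT h311 hT1a hT2 hT1b hKato hJs hJn hHs hHn hGZK hmod hpar (hGS W p)
    (fun g ι hmem =>
      exists_ordinaryPadicData_weightK_member_of_thm61_of_thm326 h61 h326 W p hp hmult hirr g ι hmem)
    (fun g ι hmem 𝔇 κ γ hκ hγ =>
      GreenbergSelmer.exists_dualData_weightK_member_unconditional W p hp hmult hirr g ι hmem 𝔇 κ γ
        hκ hγ)
    (fun g ι hmem 𝔇 κ γ hκ hγ D hfin htors =>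
      (charIdeal_isPrincipal_weightK_member_unconditional W p hp hmult hirr g ι hmem 𝔇 κ γ hκ hγ D
        hfin htors).principal)
    hp hmult hsurj hX.1 hμ

end Summit.BirchSwinnertonDyer.Rank1Residual.X11a

end
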